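/-
Copyright (c) 2026 the pub-hodgecm-mathlib formalisation cell (harness21).  Prover seat hodgecm-mathlib-K2E3-p34 (g2), Track B «K2-LIT», engine E3, unit U4 «Keys»; PART
«U4Keys» socket :182 (U4f-χ₁-ram-one-pos), programme A_pos (Roche's two-depth group; both regimes cond_F χ₁ ≤ cond_E χ₁), brick (B3) LEAF «BRANCH A AT POSITIVE DEPTH, FRAME-FREE,
LEAF-SHAPED, modulo an integral trace-one element» (pattern of K2E3-p27 (g2)'s (c3) LEAF draft and of ★ `K2E3BranchAIrreducibleDepthZeroLeaf`); dealer K2E3-plan (g5), K2 bus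
2026-09-04T23:08Z ∕ ROUND 4e.  KERNEL module: THEOREMS ONLY (no definition, no named fact, no `sorry`, no instance, no notation).
-/
import Summits.HodgeConjecture.HodgeConjecture.Theorems.K2E3BranchAIrreducibleTwoDepth         -- (B3) (this seat): `false_of_reducible_of_twoDepth` (Branch A at positive depth over `J_e`, assembled in the (G3) frame); brings ★ p863059, the frame letters
import Summits.HodgeConjecture.HodgeConjecture.Theorems.K2E3TwoDepthConductorExponents          -- ★ p862832 (K2E3-p37 g2) (B1b): `exists_conductors_and_exponents` (exact conductors, witnesses, aligned Roche exponents)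
import Summits.HodgeConjecture.HodgeConjecture.Theorems.K2E3LocalCharacterSmoothLevel           -- ★ p862872 (K2E3-p37 g2) (B1a): `exists_level_of_continuous` (continuous ⟹ smooth)
import HarnessLib

/-!
# K2 ∕ E3 «EllipticInputs», unit U4 «Keys» — (U4f-χ₁-ram-one-pos), (B3) LEAF: BRANCH A OF KEYS' THEOREM §7 (2) AT POSITIVE DEPTH, FRAME-FREE (leaf-shaped)
# «`χ₁` continuous, non-unitary, contracting, of positive depth, `χ₁(u·σu) ≠ 1` for a unit `u`, an integral trace-one element ⟹ `i(χ₁, 1)` is IRREDUCIBLE»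
# [Keys1984 §3, §7 Thm (2); Roche1998 §3–§4; Casselman1995 §6.3–§6.4; MoyPrasad1996 §3]

Cell hodgecm-mathlib, Track B «K2-LIT», engine E3, crux item H413 = `stmt-HodgeConjecture-24833` (route `HCCMUnconditional`); line `K2_E3_EllipticInputs`, PART «U4Keys»
socket :182 `sig_K2E3KeysThmTwoContractingRamifiedCharOnePosDepth`.  `--supports stmt-HodgeConjecture-24833 --as helper`; THEOREMS ONLY; NOT the :182 payer by itself — this is the
BRANCH-A HALF of :182 modulo ONE letter foreign to the socket, the integral trace-one element `t` (`t + (c ⊗ 1)t = 1`, `|t_{w′}| ≤ 1`: it exists iff `L_w ∕ L⁺_v` is NOT wildly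
ramified; at a wildly ramified dyadic `v` the socket needs another road or a re-cut — dealer's ED. 9), and Branch B at positive depth (O-182B) is the other half.

THE POINT.  ★ (B3) `K2E3BranchAIrreducibleTwoDepth.false_of_reducible_of_twoDepth` (Branch A over Roche's `J_e`, assembled in the (G3) frame) with EVERYTHING but `t` and the
Branch-A unit `u` CONSTRUCTED: the frame as in ★ `K2E3BranchAIrreducibleDepthZeroLeaf` (a place `w ∣ v`, a uniformiser, `g₁ = d(1,1,ϖ)`, `eA =` ★ `localNonsplitEquiv`, `K₀ K₁ I` by
`rfl`, `w₀ = eA⁻¹(w)`, `Measure.haar`); the conductor letters `hcond`, `hcondF`, the exact witnesses `u₁`, `u₂` and the aligned Roche exponents `(r₁, s₁; r₂, s₂)` by ★ (B1a)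
`exists_level_of_continuous` + ★ (B1b) `exists_conductors_and_exponents` from `h₁`, `hpos` (the socket's binders VERBATIM) and `hA`; the two-depth group `Jg` by ★ D174
`exists_subgroup_forall_mem_iff_twoDepth` (Roche's concavity from the alignment by `omega`), `Je := eA⁻¹(Jg)` by `rfl`; the trace-one letter read at `w` through ★
`conjLocal_apply_eq_of_smul_eq`.
* **`not_reducible_of_posDepth_of_normChar_ne_one_of_traceOne`** — frame-free, leaf-shaped (Branch A of :182 modulo `t`).
HONEST LABEL: HC_CM is proved only modulo the 7 printed citations (2 remaining named inputs: hLiu418 = stmt-HodgeConjecture-24832, h413 = stmt-HodgeConjecture-24833) until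
rung 0 closes; count-neutral — the leaf :182 stays OPEN (Branch B at positive depth; the trace-one letter at wild dyadic places; the tie is the dealer's ED. 9).

## References
* [Keys1984] D. Keys, *Principal series representations of special unitary groups over local fields*, Compositio Math. 51 (1984), §3, §7 Thm (2).
* [Roche1998] A. Roche, *Types and Hecke algebras for principal series representations of split reductive p-adic groups*, Ann. Sci. ÉNS (4) 31 (1998), §3–§4.
* [Casselman1995] W. Casselman, *Introduction to the theory of admissible representations of `p`-adic reductive groups* (1995), §6.3–§6.4.
* [MoyPrasad1996] A. Moy, G. Prasad, *Jacquet functors and unrefined minimal K-types*, Comment. Math. Helv. 71 (1996), §3.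
* [BruhatTits1972] F. Bruhat, J. Tits, *Groupes réductifs sur un corps local I*, Publ. Math. IHÉS 41 (1972), (4.4.4), (6.4.9).
* [Serre1979] J.-P. Serre, *Local Fields*, GTM 67 (1979), Ch. III §3 (trace and tame ramification).
-/

set_option autoImplicit false
-- the mandated namespace has the single-problem summit's repeated segment (`HodgeConjecture.HodgeConjecture`)
set_option linter.dupNamespace false

noncomputable section

open NumberField IsDedekindDomain MeasureTheory
open scoped Matrix MatrixGroups WithZero Valued
open Literature.NumberTheory Literature.NumberTheory.Automorphic Literature.NumberTheory.Automorphic.UnitaryGroup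
open Literature.NumberTheory.Rogawski1990

namespace Summit.HodgeConjecture.HodgeConjecture.Cruxes.H413.K2E3BranchAIrreducibleTwoDepthLeaf

open Summit.HodgeConjecture.HodgeConjecture.Cruxes.H413
open Summit.HodgeConjecture.HodgeConjecture.Cruxes.H413.K2E3DepthZeroIwahoriCharacterCM
open Summit.HodgeConjecture.HodgeConjecture.Cruxes.H413.K2E3BranchAIrreducibleTwoDepth

variable (L : Type) [Field L] [NumberField L] [IsCMField L] (v : HeightOneSpectrum (𝓞 ↥(maximalRealSubfield L)))

/-! ## Branch A at positive depth, frame-free (leaf-shaped) modulo an integral trace-one element -/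

open Classical in
set_option maxHeartbeats 1600000 in
set_option synthInstance.maxHeartbeats 400000 in
-- ★ (B3) instantiated: the frame, `Jg`∕`Je`, `w₀ = eA⁻¹(w)`, the Haar measure of `N` (class of ★ p863059 §3 ∕ ★ `K2E3BranchAIrreducibleDepthZeroLeaf`)
/-- **BRANCH A OF KEYS' THEOREM §7 (2) AT POSITIVE DEPTH, frame-free (leaf-shaped), modulo an integral trace-one element.**  `v` non-split (`hns`); `χ₁ : (L ⊗ L⁺_v)ˣ → ℂˣ`
continuous (`h₁`), non-unitary (`hnu`), contracting (`hcontr`), of POSITIVE depth (`hpos`: some `u′` with `|u′_{w′} − 1| < 1` for all `w′` has `χ₁ u′ ≠ 1` — the socket's binder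
VERBATIM); an integral trace-one element `t` of `L ⊗ L⁺_v` (`t + (c ⊗ 1) t = 1`, `|t_{w′}| ≤ 1` — tameness of `L_w ∕ L⁺_v`); `u` a unit with `|u_{w′}| = 1` and `χ₁(u · σu) ≠ 1` (Branch A:
`χ₁ ∘ N ≠ 1` on `𝒪ˣ`).  Then the principal series `i(χ₁, 1)` of `U(Φ₃)(L⁺_v)` has no `G`-stable subspace other than `⊥`, `⊤`.  Proof: ★ (B3) `false_of_reducible_of_twoDepth` with everything else CONSTRUCTED — the frame
(★ depth-zero LEAF pattern), the conductor letters and aligned Roche exponents (★ (B1a) `exists_level_of_continuous`, ★ (B1b) `exists_conductors_and_exponents`), the two-depth group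
(★ D174 `exists_subgroup_forall_mem_iff_twoDepth`), `w₀ = eA⁻¹(w)`, `Measure.haar`, and the trace-one letter read at `w` (★ `conjLocal_apply_eq_of_smul_eq`).
[cite: Keys1984, §3, §7 Thm (2)] [cite: Roche1998, §3–§4] [cite: Casselman1995, §6.3–§6.4] [cite: MoyPrasad1996, §3] [cite: Serre1979, Ch. III §3] -/
theorem not_reducible_of_posDepth_of_normChar_ne_one_of_traceOne
    (hns : ∀ w' : PlacesOver L v, IsCMField.complexConj L • w'.1 = w'.1)
    (χ₁ : (LocalRing L v)ˣ →* ℂˣ) (h₁ : Continuous fun x => ((χ₁ x : ℂˣ) : ℂ)) (hnu : ∃ x, ‖((χ₁ x : ℂˣ) : ℂ)‖ ≠ 1)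
    (hcontr : ∀ x : (LocalRing L v)ˣ, unitModulusChar (LocalRing L v) x < 1 → ‖((χ₁ x : ℂˣ) : ℂ)‖ < 1)
    (hpos : ∃ u : (LocalRing L v)ˣ, (∀ w' : PlacesOver L v, Valued.v (((u : LocalRing L v) w') - 1) < 1) ∧ χ₁ u ≠ 1)
    (t : LocalRing L v) (ht : t + conjLocal L (IsCMField.complexConj L) v t = 1) (hvt : ∀ w' : PlacesOver L v, Valued.v (t w') ≤ 1)
    (u : (LocalRing L v)ˣ) (hu : ∀ w' : PlacesOver L v, Valued.v ((u : LocalRing L v) w') = 1)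
    (hA : χ₁ (u * Units.map (conjLocal L (IsCMField.complexConj L) v : LocalRing L v →* LocalRing L v) u) ≠ 1) :
    ¬ ∃ N : Subrepresentation (cmPrincipalSeries L 3 v (cmTorusCharPair L v χ₁ 1)), N ≠ ⊥ ∧ N ≠ ⊤ := by
  classical
  intro hred
  obtain ⟨w⟩ : Nonempty (PlacesOver L v) := inferInstance
  have hw : IsCMField.complexConj L • w.1 = w.1 := hns w
  -- the (G3)-EXPLICIT letters (★ `K2E3BranchAIrreducibleDepthZeroLeaf` pattern): a uniformiser, `g₁`, `eA =` ★ `localNonsplitEquiv` on `Φ₃`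
  obtain ⟨ϖ, hϖ⟩ : ∃ τ : w.1.adicCompletion L, Valued.v τ = WithZero.exp (-1 : ℤ) := by
    obtain ⟨π, hπ⟩ := w.1.valuation_exists_uniformizer L
    exact ⟨(π : w.1.adicCompletion L), by rw [HeightOneSpectrum.valuedAdicCompletion_eq_valuation', hπ]⟩
  have hϖ0 : ϖ ≠ 0 := fun h0 => by rw [h0, map_zero] at hϖ; exact WithZero.zero_ne_coe hϖ
  have hvσ : ∀ x, Valued.v (galAdicCompletionMap (L := L) (IsCMField.complexConj L) hw x) = Valued.v x :=
    fun x => valued_galAdicCompletionMap (L := L) (IsCMField.complexConj L) hw x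
  obtain ⟨g₁, hg₁⟩ : ∃ g₁ : GL (Fin 3) (w.1.adicCompletion L), (g₁ : Matrix (Fin 3) (Fin 3) (w.1.adicCompletion L)) = Matrix.diagonal ![(1 : w.1.adicCompletion L), 1, ϖ] := by
    refine ⟨glDiagonal 3 (w.1.adicCompletion L) ![1, 1, Units.mk0 ϖ hϖ0], ?_⟩
    rw [coe_glDiagonal]
    congr 1
    funext i
    fin_cases i <;> rfl
  have hJw : placeForm (qsForm L) w.1 = (StdForm.antidiagonal 3).over (w.1.adicCompletion L) := by
    rw [placeForm, qsForm, antidiagOne_eq_over, StdForm.over_map]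
  obtain ⟨eA, heA⟩ : ∃ eA : Gqs L v ≃ₜ* ↥(unitaryGroupOfForm (galAdicCompletionMap (L := L) (IsCMField.complexConj L) hw) ((StdForm.antidiagonal 3).over (w.1.adicCompletion L))),
      ∀ g : Gqs L v, ((eA g : ↥(unitaryGroupOfForm (galAdicCompletionMap (L := L) (IsCMField.complexConj L) hw) ((StdForm.antidiagonal 3).over (w.1.adicCompletion L)))) :
          GL (Fin 3) (w.1.adicCompletion L)) =
        ((localNonsplitEquiv (IsCMField.complexConj L) (qsForm L) (IsCMField.complexConj_ne_one L) w hw g :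
          ↥(unitaryGroupOfForm (galAdicCompletionMap (L := L) (IsCMField.complexConj L) hw) (placeForm (qsForm L) w.1))) : GL (Fin 3) (w.1.adicCompletion L)) := by
    rw [← hJw]
    exact ⟨localNonsplitEquiv (IsCMField.complexConj L) (qsForm L) (IsCMField.complexConj_ne_one L) w hw, fun g => rfl⟩
  -- the conductor letters, the exact witnesses and the aligned Roche exponents: ★ (B1a) + ★ (B1b)
  obtain ⟨m, k, r₁, s₁, r₂, s₂, hm, hkm, hrr, hss, hr1, hr2, hs1, hs2, hal, -, hcond, hcondF, ⟨u₁, hu₁, hχu₁⟩, ⟨u₂, hσu₂, hu₂, hχu₂⟩⟩ :=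
    K2E3TwoDepthConductorExponents.exists_conductors_and_exponents L v w hϖ χ₁
      (K2E3LocalCharacterSmoothLevel.exists_level_of_continuous L v w hϖ χ₁ h₁) hpos ⟨u, hu, hA⟩ hns
  -- Roche's two-depth group `Jg` (★ D174; concavity from the alignment) and `Je := eA⁻¹(Jg)`
  obtain ⟨Jg, hJg⟩ := K2E3IwahoriTwoDepthFactorisation.exists_subgroup_forall_mem_iff_twoDepth (galAdicCompletionMap (L := L) (IsCMField.complexConj L) hw)
    (rfl : (StdForm.antidiagonal 3).over (w.1.adicCompletion L) = _) hvσ hϖ (r := r₁) (s := s₁) (r' := r₂) (s' := s₂)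
    (by omega) (by omega) (by omega) (by omega)
  -- the trace-one letter read at `w`
  have htw : t w + galAdicCompletionMap (L := L) (IsCMField.complexConj L) hw (t w) = 1 := by
    rw [← conjLocal_apply_eq_of_smul_eq (IsCMField.complexConj L) (IsCMField.complexConj_ne_one L) v w hw t]
    have h := congr_fun ht w
    rw [Pi.add_apply, Pi.one_apply] at h
    exact h
  -- `w₀ = eA⁻¹(w)` has matrix `Φ₃`
  have hw₀ : Units.val ((eA.symm (weylLongU (galAdicCompletionMap (L := L) (IsCMField.complexConj L) hw)
      (rfl : (StdForm.antidiagonal 3).over (w.1.adicCompletion L) = _))).val : GL (Fin 3) (LocalRing L v)) = cmLocalForm L 3 v := by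
    refine Matrix.ext fun i j => ?_
    rw [LocalRing.eq_iff_apply_eq (IsCMField.complexConj L) (IsCMField.complexConj_ne_one L) w hw,
      ← coe_eA_apply L v w hw eA heA (eA.symm (weylLongU (galAdicCompletionMap (L := L) (IsCMField.complexConj L) hw) rfl)) i j,
      ContinuousMulEquiv.apply_symm_apply, coe_coe_weylLongU, cmLocalForm_eq_over]
    have h := congr_fun (congr_fun ((StdForm.antidiagonal 3).over_map (Pi.evalRingHom (fun w' : PlacesOver L v => w'.1.adicCompletion L) w)) i) j
    rw [Matrix.map_apply, Pi.evalRingHom_apply] at h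
    exact h.symm
  -- the Haar measure of the closed subgroup `N(L⁺_v)`
  letI : MeasurableSpace ↥(cmBorelTriple L 3 v).N := borel _
  haveI : BorelSpace ↥(cmBorelTriple L 3 v).N := ⟨rfl⟩
  haveI : LocallyCompactSpace ↥(unitaryGroupOfForm (conjLocal L (IsCMField.complexConj L) v) (cmLocalForm L 3 v)) :=
    locallyCompactSpace_local (IsCMField.complexConj L) 3 _ v
  haveI : LocallyCompactSpace ↥(cmBorelTriple L 3 v).N :=
    (LineRing.isClosed_unipotentU (conjLocal L (IsCMField.complexConj L) v) (cmLocalForm L 3 v)).isClosedEmbedding_subtypeVal.locallyCompactSpace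
  exact false_of_reducible_of_twoDepth L v w hw eA heA hϖ g₁ hg₁ _ _ _ rfl rfl rfl r₁ s₁ r₂ s₂ Jg hJg _ rfl hns χ₁ h₁ hnu hcontr hm hkm hrr hss hr1 hr2 hs1 hs2 hal
    hcond hcondF u₁ hu₁ hχu₁ u₂ hσu₂ hu₂ hχu₂ htw (hvt w) u hu hA
    (eA.symm (weylLongU (galAdicCompletionMap (L := L) (IsCMField.complexConj L) hw) (rfl : (StdForm.antidiagonal 3).over (w.1.adicCompletion L) = _)))
    hw₀ Measure.haar hred

/-! ## ED. 2 (append-only): the non-dyadic case — the trace-one element `t = 1∕2` -/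

/-- **BRANCH A OF KEYS' THEOREM §7 (2) AT POSITIVE DEPTH, frame-free (leaf-shaped), at a NON-DYADIC `v`.**  The trace-one letter of
`not_reducible_of_posDepth_of_normChar_ne_one_of_traceOne` discharged by `t := 1∕2` when `|2|_{w′} = 1` for all `w′ ∣ v` (the letter `h2` of ★ p863059 ∕ the (c3) chain, read at
every place): `(c ⊗ 1)(1∕2) = 1∕2` (★ `conjLocal_apply_eq_of_smul_eq`, `map_inv₀`, `map_ofNat`), `1∕2 + 1∕2 = 1`, `|1∕2|_{w′} = 1`.  So at a non-dyadic non-split `v`: `χ₁` continuous,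
non-unitary, contracting, of positive depth, and `χ₁(u·σu) ≠ 1` for a unit `u` ⟹ `i(χ₁, 1)` has no `G`-stable subspace other than `⊥`, `⊤` — NO letter foreign to the socket :182 beyond
non-dyadicness. [cite: Keys1984, §3, §7 Thm (2)] [cite: Roche1998, §3–§4] [cite: Serre1979, Ch. III §3] -/
theorem not_reducible_of_posDepth_of_normChar_ne_one_of_v_two
    (hns : ∀ w' : PlacesOver L v, IsCMField.complexConj L • w'.1 = w'.1)
    (χ₁ : (LocalRing L v)ˣ →* ℂˣ) (h₁ : Continuous fun x => ((χ₁ x : ℂˣ) : ℂ)) (hnu : ∃ x, ‖((χ₁ x : ℂˣ) : ℂ)‖ ≠ 1)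
    (hcontr : ∀ x : (LocalRing L v)ˣ, unitModulusChar (LocalRing L v) x < 1 → ‖((χ₁ x : ℂˣ) : ℂ)‖ < 1)
    (hpos : ∃ u : (LocalRing L v)ˣ, (∀ w' : PlacesOver L v, Valued.v (((u : LocalRing L v) w') - 1) < 1) ∧ χ₁ u ≠ 1)
    (h2 : ∀ w' : PlacesOver L v, Valued.v (2 : w'.1.adicCompletion L) = 1)
    (u : (LocalRing L v)ˣ) (hu : ∀ w' : PlacesOver L v, Valued.v ((u : LocalRing L v) w') = 1)
    (hA : χ₁ (u * Units.map (conjLocal L (IsCMField.complexConj L) v : LocalRing L v →* LocalRing L v) u) ≠ 1) :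
    ¬ ∃ N : Subrepresentation (cmPrincipalSeries L 3 v (cmTorusCharPair L v χ₁ 1)), N ≠ ⊥ ∧ N ≠ ⊤ := by
  have h20 : ∀ w' : PlacesOver L v, (2 : w'.1.adicCompletion L) ≠ 0 := fun w' h0 => by
    have h := h2 w'
    rw [h0, map_zero] at h
    exact zero_ne_one h
  refine not_reducible_of_posDepth_of_normChar_ne_one_of_traceOne L v hns χ₁ h₁ hnu hcontr hpos (fun w' => (2 : w'.1.adicCompletion L)⁻¹)
    (funext fun w' => ?_) (fun w' => ?_) u hu hA
  · -- `1∕2 + (c ⊗ 1)(1∕2) = 1` at the place `w′`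
    rw [Pi.add_apply, Pi.one_apply, conjLocal_apply_eq_of_smul_eq (IsCMField.complexConj L) (IsCMField.complexConj_ne_one L) v w' (hns w'), map_inv₀, map_ofNat,
      ← two_mul, mul_inv_cancel₀ (h20 w')]
  · -- `|1∕2|_{w′} = 1`
    rw [map_inv₀, h2 w', inv_one]

end Summit.HodgeConjecture.HodgeConjecture.Cruxes.H413.K2E3BranchAIrreducibleTwoDepthLeaf

end
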